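import Summits.CriticalPhenomena.PercolationContinuityZ3.Theorems.PercNearOneGluingNoHeavyLowerTailSahiTransportJRData4

/-!
# `NoHeavyLowerTail` (crux stmt-CriticalPhenomena-4575), Sahi / Kahn positivity: parameter-free transport certificates on `2^4` — evaluation A

Support file (cell `prim-l12`, seat P3, gen 5; `--supports stmt-CriticalPhenomena-4575`).  Computational (`native_decide`): the digit test
`SahiTransportJR.checkTab 33 4 M (certTab4 M)` — structure of the table, every capacity row and all `14 196` transport rows `X ≤ Z` over the `168`
increasing bitmasks of `2^4`, each a `256`-digit base-`2^33` Kronecker-number test — passes for the 28 nontrivial increasing pattern events `M` of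
batch A (`batch4A`).  Six batches A–F cover the `163` events of `2^4` outside the `K₂,₂` orbit; with `…SahiTransportJRSound.sahiE_three_nonneg_of_checkTab`
each gives Kahn's Conjecture 5 / Sahi's `C₃` for that junta first slot, the other two increasing events arbitrary, every dimension. [this work]
-/

namespace Summit.CriticalPhenomena.PercolationContinuityZ3.Theorems.SahiTransportJR

/-- Batch A of certified pattern events of `2^4` (bitmasks over the `16` points). [this work] -/
def batch4A : List ℕ := [32768, 32896, 34816, 34944, 34952, 40960, 41088, 41120, 43008, 43136, 43144, 43168, 43176, 43520, 43648, 43656, 43680, 43688, 43690, 49152, 49280, 49344, 51200, 51328, 51336, 51392, 51400, 52224]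

/-- Every event of batch A passes the certificate check (kernel evaluation via `native_decide`). [this work] -/
theorem checkTab4_batchA : (batch4A.all fun M => checkTab 33 4 M (certTab4 M)) = true := by native_decide

/-- Pointwise form. [this work] -/
theorem checkTab4_of_mem_batchA {M : ℕ} (h : M ∈ batch4A) : checkTab 33 4 M (certTab4 M) = true :=
  List.all_eq_true.1 checkTab4_batchA M h

end Summit.CriticalPhenomena.PercolationContinuityZ3.Theorems.SahiTransportJR
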